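import Summits.PneNP.PneNP.Theorems.KarlinRubinMonotoneBlindDnfBounds
import Literature.Computability.Complexity.RandomOraclePHAsymptotics

/-!
# Route KarlinRubin, crux `MonotoneBlind` (stmt-PneNP-18027): quiet polynomial-size monotone DNFs are blind (level 3b)

The depth-2 case of the crux, settled. A monotone DNF on the edge slots of `Kₙ` is given by its term family `𝓔 n`
(it accepts `x` iff `∃ E ∈ 𝓔 n, E ⊆ x`). **Theorem** (`karlinRubin_dnf_planted_tendsto_zero`): for `0 < δ < 1/2` and
every `c`, if `#(𝓔 n) ≤ n^c` eventually and the null acceptance `Pr_{G(n,1/2)}[f_{𝓔 n} = 1] → 0`, then the planted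
acceptance `Pr_{G(n,1/2) ∪ K_A, |A| = ⌈n^{1/2-δ}⌉}[f_{𝓔 n} = 1] → 0` as well. Hence (`karlinRubin_monotoneBlind_dnf`)
NO family of monotone DNFs with polynomially many terms — of any widths — has error sum `→ 0`, and
(`karlinRubin_not_detects_of_computes_dnf`) no circuit family computing such DNFs strongly detects: the statement of
`MonotoneBlind` restricted to depth 2, with no width restriction and no bound on the null firing count (both needed by
the planner's `NarrowDnfBlind` end-game). The engine is the witness lemma of `KarlinRubinMonotoneBlindDnfWitness.lean`
(quietness forces planted witnesses to carry `> t` planted edges) and a hypergeometric tail per term; this file supplies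
the asymptotics: the numeric hypotheses of `dnf_termBound_two_inv` hold eventually for `k = ⌈n^{1/2-δ}⌉`
(`(2L⁴d)² ≤ n` from `(log n)^8 = o(n^{2δ})`, the others from `n^{-δ} → 0`).

All `--supports stmt-PneNP-18027`; no definitions.
-/

set_option linter.dupNamespace false -- `Summit.PneNP.PneNP.…`: summit = sub-problem (D-0017)

namespace Summit.PneNP.PneNP.Theorems

open Filter Topology Finset Asymptotics
open scoped ENNReal
open Literature.Computability.Complexity
open Literature.Probability.RandomGraphs.PlantedClique

/-! ### The per-`n` bound with a polynomial number of terms -/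

/-- `n^c · (n^{c+2})⁻¹ = (n²)⁻¹` in `ℝ≥0∞` (`0 < n`). [folklore] -/
theorem natCast_pow_mul_inv_pow_add_two {n : ℕ} (hn : 0 < n) (c : ℕ) :
    ((n ^ c : ℕ) : ℝ≥0∞) * (((n ^ (c + 2) : ℕ) : ℝ≥0∞))⁻¹ = (((n ^ 2 : ℕ) : ℝ≥0∞))⁻¹ := by
  have h0 : ((n ^ c : ℕ) : ℝ≥0∞) ≠ 0 := by exact_mod_cast (pow_pos hn c).ne'
  have htop : ((n ^ c : ℕ) : ℝ≥0∞) ≠ ⊤ := ENNReal.natCast_ne_top _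
  have hsplit : ((n ^ (c + 2) : ℕ) : ℝ≥0∞) = ((n ^ c : ℕ) : ℝ≥0∞) * ((n ^ 2 : ℕ) : ℝ≥0∞) := by
    rw [pow_add, Nat.cast_mul]
  rw [hsplit, ENNReal.mul_inv (Or.inl h0) (Or.inl htop), ← mul_assoc, ENNReal.mul_inv_cancel h0 htop, one_mul]

/-- **Per-`n` bound.** Under the numeric hypotheses of `dnf_termBound_two_inv` and `#𝓔 ≤ n^c`, the planted
acceptance of `f_𝓔` is at most `2^{C(2c+3,2)} · (null acceptance) + 2 (n²)⁻¹`. [folklore] -/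
theorem dnf_planted_le_null_add {n : ℕ} (hn : 0 < n) (k : ℕ) {L c : ℕ}
    (H1 : (2 * L ^ 4 * (min k n)) ^ 2 ≤ n) (H2 : 12 * (Nat.sqrt n + 1) * (min k n) ≤ n)
    (H3 : 6 * (min k n) ≤ Nat.sqrt n + 1) (hL : c + 3 ≤ L) (hnL : n < 2 ^ (L + 1))
    (𝓔 : Finset (Finset (⊤ : SimpleGraph (Fin n)).edgeSet)) (hM : #𝓔 ≤ n ^ c) :
    (plantedCliqueDist n k).toOuterMeasure {x | ∃ E ∈ 𝓔, ∀ e ∈ E, x e = true} ≤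
      2 ^ ((2 * (c + 2) - 1).choose 2) *
          (erdosRenyiHalf n).toOuterMeasure {x | ∃ E ∈ 𝓔, ∀ e ∈ E, x e = true} +
        2 * (((n ^ 2 : ℕ) : ℝ≥0∞))⁻¹ := by
  refine (dnf_planted_le_of_termBound k ((2 * (c + 2) - 1).choose 2) 𝓔
    (fun _ => 2 * (((n ^ (c + 2) : ℕ) : ℝ≥0∞))⁻¹)
    (fun E _ => dnf_termBound_two_inv hn k H1 H2 H3 hL hnL E)).trans ?_
  gcongr
  rw [sum_const, nsmul_eq_mul]
  calc (#𝓔 : ℝ≥0∞) * (2 * (((n ^ (c + 2) : ℕ) : ℝ≥0∞))⁻¹)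
      ≤ ((n ^ c : ℕ) : ℝ≥0∞) * (2 * (((n ^ (c + 2) : ℕ) : ℝ≥0∞))⁻¹) :=
        mul_le_mul' (by exact_mod_cast hM) le_rfl
    _ = 2 * (((n ^ c : ℕ) : ℝ≥0∞) * (((n ^ (c + 2) : ℕ) : ℝ≥0∞))⁻¹) := by ring
    _ = 2 * (((n ^ 2 : ℕ) : ℝ≥0∞))⁻¹ := by rw [natCast_pow_mul_inv_pow_add_two hn c]

/-! ### The numeric hypotheses hold eventually for `k = ⌈n^{1/2-δ}⌉` -/

/-- `⌈n^{1/2-δ}⌉ ≤ 2 n^{1/2-δ}` for `n ≥ 1` (the ceiling adds `< 1 ≤ n^{1/2-δ}`). [folklore] -/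
theorem ceil_rpow_le_two_mul {δ : ℝ} (hδ' : δ < 1 / 2) {n : ℕ} (hn : 1 ≤ n) :
    (⌈(n : ℝ) ^ (1 / 2 - δ)⌉₊ : ℝ) ≤ 2 * (n : ℝ) ^ (1 / 2 - δ) := by
  have hn' : (1 : ℝ) ≤ n := by exact_mod_cast hn
  have h1 : (1 : ℝ) ≤ (n : ℝ) ^ (1 / 2 - δ) := Real.one_le_rpow hn' (by linarith)
  have h2 : (⌈(n : ℝ) ^ (1 / 2 - δ)⌉₊ : ℝ) < (n : ℝ) ^ (1 / 2 - δ) + 1 :=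
    Nat.ceil_lt_add_one (by positivity)
  linarith

/-- `n^{1/2-δ} = n^{1/2} · n^{-δ}` (`n > 0`). [folklore] -/
theorem rpow_half_sub_eq {δ : ℝ} {n : ℕ} (hn : 0 < n) :
    (n : ℝ) ^ (1 / 2 - δ) = (n : ℝ) ^ (1 / 2 : ℝ) * (n : ℝ) ^ (-δ) := by
  rw [← Real.rpow_add (by exact_mod_cast hn)]; ring_nf

/-- **H3 eventually**: `6 · min(⌈n^{1/2-δ}⌉, n) ≤ ⌊√n⌋ + 1`. [folklore] -/
theorem eventually_H3 {δ : ℝ} (hδ : 0 < δ) (hδ' : δ < 1 / 2) :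
    ∀ᶠ n : ℕ in atTop, 6 * min ⌈(n : ℝ) ^ (1 / 2 - δ)⌉₊ n ≤ Nat.sqrt n + 1 := by
  have hneg : Tendsto (fun n : ℕ => (n : ℝ) ^ (-δ)) atTop (𝓝 0) :=
    (tendsto_rpow_neg_atTop hδ).comp tendsto_natCast_atTop_atTop
  have hhalf : Tendsto (fun n : ℕ => (n : ℝ) ^ (1 / 2 : ℝ)) atTop atTop :=
    (tendsto_rpow_atTop (by norm_num)).comp tendsto_natCast_atTop_atTop
  filter_upwards [hneg.eventually_le_const (show (0 : ℝ) < 1 / 24 by norm_num),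
    hhalf.eventually_ge_atTop 24, eventually_ge_atTop 1] with n h1 h2 hn1
  have hnpos : 0 < n := hn1
  -- real inequality `6 ⌈n^{1/2-δ}⌉ ≤ √n`
  have hreal : (6 * ⌈(n : ℝ) ^ (1 / 2 - δ)⌉₊ : ℝ) ≤ (n : ℝ) ^ (1 / 2 : ℝ) := by
    have hc : (⌈(n : ℝ) ^ (1 / 2 - δ)⌉₊ : ℝ) ≤ 2 * ((n : ℝ) ^ (1 / 2 : ℝ) * (n : ℝ) ^ (-δ)) := by
      rw [← rpow_half_sub_eq hnpos]; exact ceil_rpow_le_two_mul hδ' hn1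
    have hpos : (0 : ℝ) ≤ (n : ℝ) ^ (1 / 2 : ℝ) := by positivity
    have hprod : (n : ℝ) ^ (1 / 2 : ℝ) * (n : ℝ) ^ (-δ) ≤ (n : ℝ) ^ (1 / 2 : ℝ) * (1 / 24) :=
      mul_le_mul_of_nonneg_left h1 hpos
    nlinarith
  -- `√n < ⌊√n⌋ + 1`
  have hsqrt : (n : ℝ) ^ (1 / 2 : ℝ) < (Nat.sqrt n + 1 : ℕ) := by
    rw [← Real.sqrt_eq_rpow, Real.sqrt_lt' (by positivity)]
    exact_mod_cast Nat.lt_succ_sqrt' n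
  have h : (6 * min ⌈(n : ℝ) ^ (1 / 2 - δ)⌉₊ n : ℕ) < Nat.sqrt n + 1 := by
    have hmin : ((6 * min ⌈(n : ℝ) ^ (1 / 2 - δ)⌉₊ n : ℕ) : ℝ) ≤ 6 * ⌈(n : ℝ) ^ (1 / 2 - δ)⌉₊ := by
      have : min ((⌈(n : ℝ) ^ (1 / 2 - δ)⌉₊ : ℕ) : ℝ) (n : ℝ) ≤ ⌈(n : ℝ) ^ (1 / 2 - δ)⌉₊ := min_le_left _ _
      push_cast
      linarith
    exact_mod_cast (hmin.trans hreal).trans_lt hsqrt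
  omega

/-- **H2 eventually**: `12 (⌊√n⌋ + 1) · min(⌈n^{1/2-δ}⌉, n) ≤ n`. [folklore] -/
theorem eventually_H2 {δ : ℝ} (hδ : 0 < δ) (hδ' : δ < 1 / 2) :
    ∀ᶠ n : ℕ in atTop, 12 * (Nat.sqrt n + 1) * min ⌈(n : ℝ) ^ (1 / 2 - δ)⌉₊ n ≤ n := by
  have hneg : Tendsto (fun n : ℕ => (n : ℝ) ^ (-δ)) atTop (𝓝 0) :=
    (tendsto_rpow_neg_atTop hδ).comp tendsto_natCast_atTop_atTop
  filter_upwards [hneg.eventually_le_const (show (0 : ℝ) < 1 / 48 by norm_num), eventually_ge_atTop 1]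
    with n h1 hn1
  have hnpos : 0 < n := hn1
  have hnR : (1 : ℝ) ≤ n := by exact_mod_cast hn1
  have hsq : (Nat.sqrt n : ℝ) ≤ (n : ℝ) ^ (1 / 2 : ℝ) := by
    rw [← Real.sqrt_eq_rpow]
    calc (Nat.sqrt n : ℝ) = Real.sqrt (((Nat.sqrt n : ℕ) : ℝ) ^ 2) := (Real.sqrt_sq (Nat.cast_nonneg _)).symm
      _ ≤ Real.sqrt n := Real.sqrt_le_sqrt (by exact_mod_cast Nat.sqrt_le' n)
  have hhalf1 : (1 : ℝ) ≤ (n : ℝ) ^ (1 / 2 : ℝ) := Real.one_le_rpow hnR (by norm_num)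
  have hc : (⌈(n : ℝ) ^ (1 / 2 - δ)⌉₊ : ℝ) ≤ 2 * ((n : ℝ) ^ (1 / 2 : ℝ) * (n : ℝ) ^ (-δ)) := by
    rw [← rpow_half_sub_eq hnpos]; exact ceil_rpow_le_two_mul hδ' hn1
  have hnn : (n : ℝ) ^ (1 / 2 : ℝ) * (n : ℝ) ^ (1 / 2 : ℝ) = n := by
    rw [← Real.rpow_add (by exact_mod_cast hnpos)]; norm_num
  have hreal : ((12 * (Nat.sqrt n + 1) * min ⌈(n : ℝ) ^ (1 / 2 - δ)⌉₊ n : ℕ) : ℝ) ≤ n := by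
    have hmin : min ((⌈(n : ℝ) ^ (1 / 2 - δ)⌉₊ : ℕ) : ℝ) (n : ℝ) ≤ ⌈(n : ℝ) ^ (1 / 2 - δ)⌉₊ :=
      min_le_left _ _
    have hA : ((Nat.sqrt n : ℕ) : ℝ) + 1 ≤ 2 * (n : ℝ) ^ (1 / 2 : ℝ) := by linarith
    have hB : min ((⌈(n : ℝ) ^ (1 / 2 - δ)⌉₊ : ℕ) : ℝ) (n : ℝ) ≤ 2 * ((n : ℝ) ^ (1 / 2 : ℝ) * (n : ℝ) ^ (-δ)) :=
      hmin.trans hc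
    have hpos1 : (0 : ℝ) ≤ (n : ℝ) ^ (1 / 2 : ℝ) := by positivity
    have hpos2 : (0 : ℝ) ≤ (n : ℝ) ^ (-δ) := by positivity
    push_cast
    calc (12 * (((Nat.sqrt n : ℕ) : ℝ) + 1) * min ((⌈(n : ℝ) ^ (1 / 2 - δ)⌉₊ : ℕ) : ℝ) (n : ℝ))
        ≤ 12 * (2 * (n : ℝ) ^ (1 / 2 : ℝ)) * (2 * ((n : ℝ) ^ (1 / 2 : ℝ) * (n : ℝ) ^ (-δ))) := by
          gcongr
      _ = 48 * ((n : ℝ) ^ (1 / 2 : ℝ) * (n : ℝ) ^ (1 / 2 : ℝ)) * (n : ℝ) ^ (-δ) := by ring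
      _ = 48 * n * (n : ℝ) ^ (-δ) := by rw [hnn]
      _ ≤ 48 * n * (1 / 48) := by gcongr
      _ = n := by ring
  exact_mod_cast hreal

/-- **H1 eventually**: `(2 ⌊log₂ n⌋⁴ · min(⌈n^{1/2-δ}⌉, n))² ≤ n` (from `(log n)^8 = o(n^{2δ})`). [folklore] -/
theorem eventually_H1 {δ : ℝ} (hδ : 0 < δ) (hδ' : δ < 1 / 2) :
    ∀ᶠ n : ℕ in atTop, (2 * (Nat.log 2 n) ^ 4 * min ⌈(n : ℝ) ^ (1 / 2 - δ)⌉₊ n) ^ 2 ≤ n := by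
  -- `(log x)^8 ≤ (1/4096) x^{2δ}` eventually
  have hlo : (fun x : ℝ => Real.log x ^ 8) =o[atTop] fun x : ℝ => (x ^ (δ / 4)) ^ 8 :=
    (isLittleO_log_rpow_atTop (by positivity : 0 < δ / 4)).pow (by norm_num)
  have hev := (hlo.comp_tendsto tendsto_natCast_atTop_atTop).def (show (0 : ℝ) < 1 / 4096 by norm_num)
  have hneg1 : ∀ᶠ n : ℕ in atTop, (1 : ℝ) ≤ (n : ℝ) ^ (1 / 2 - δ) := by
    filter_upwards [eventually_ge_atTop 1] with n hn
    exact Real.one_le_rpow (by exact_mod_cast hn) (by linarith)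
  filter_upwards [hev, eventually_ge_atTop 1] with n hlog hn1
  have hnpos : 0 < n := hn1
  have hnR : (0 : ℝ) < n := by exact_mod_cast hnpos
  -- unpack the little-o bound
  have hlog8 : Real.log n ^ 8 ≤ 1 / 4096 * (n : ℝ) ^ (2 * δ) := by
    have h := hlog
    simp only [Function.comp, Real.norm_eq_abs] at h
    rw [abs_of_nonneg (pow_nonneg (Real.log_nonneg (by exact_mod_cast hn1)) 8),
      abs_of_nonneg (by positivity)] at h
    have hpow : ((n : ℝ) ^ (δ / 4)) ^ 8 = (n : ℝ) ^ (2 * δ) := by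
      have h8 : δ / 4 * ((8 : ℕ) : ℝ) = 2 * δ := by push_cast; ring
      rw [← Real.rpow_natCast, ← Real.rpow_mul hnR.le, h8]
    rwa [hpow] at h
  have hL : (Nat.log 2 n : ℝ) ≤ 2 * Real.log n := natLog_two_le_two_mul_log hn1
  have hL0 : (0 : ℝ) ≤ Nat.log 2 n := Nat.cast_nonneg _
  have hd : min ((⌈(n : ℝ) ^ (1 / 2 - δ)⌉₊ : ℕ) : ℝ) (n : ℝ) ≤ 2 * (n : ℝ) ^ (1 / 2 - δ) :=
    (min_le_left _ _).trans (ceil_rpow_le_two_mul hδ' hn1)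
  have hsplit : ((n : ℝ) ^ (1 / 2 - δ)) ^ 2 * (n : ℝ) ^ (2 * δ) = n := by
    have h2 : (1 / 2 - δ) * ((2 : ℕ) : ℝ) + 2 * δ = 1 := by push_cast; ring
    rw [← Real.rpow_natCast, ← Real.rpow_mul hnR.le, ← Real.rpow_add hnR, h2, Real.rpow_one]
  have hreal : (((2 * (Nat.log 2 n) ^ 4 * min ⌈(n : ℝ) ^ (1 / 2 - δ)⌉₊ n) ^ 2 : ℕ) : ℝ) ≤ n := by
    have hlogn : 0 ≤ Real.log n := Real.log_nonneg (by exact_mod_cast hn1)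
    have hp : (0 : ℝ) ≤ (n : ℝ) ^ (1 / 2 - δ) := by positivity
    push_cast
    calc ((2 * ((Nat.log 2 n : ℕ) : ℝ) ^ 4 * min ((⌈(n : ℝ) ^ (1 / 2 - δ)⌉₊ : ℕ) : ℝ) (n : ℝ)) ^ 2 : ℝ)
        ≤ (2 * (2 * Real.log n) ^ 4 * (2 * (n : ℝ) ^ (1 / 2 - δ))) ^ 2 := by gcongr
      _ = 4096 * (Real.log n ^ 8) * ((n : ℝ) ^ (1 / 2 - δ)) ^ 2 := by ring
      _ ≤ 4096 * (1 / 4096 * (n : ℝ) ^ (2 * δ)) * ((n : ℝ) ^ (1 / 2 - δ)) ^ 2 := by gcongr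
      _ = ((n : ℝ) ^ (1 / 2 - δ)) ^ 2 * (n : ℝ) ^ (2 * δ) := by ring
      _ = n := hsplit
  exact_mod_cast hreal

/-! ### The theorem -/

/-- **Quiet polynomial-size monotone DNFs are blind to the planted clique.** For `0 < δ < 1/2` and `c : ℕ`: if the
term families `𝓔 n` have `#(𝓔 n) ≤ n^c` eventually and null acceptance `Pr_{G(n,1/2)}[∃ E ∈ 𝓔 n, E ⊆ x] → 0`, then
the planted acceptance `Pr_{G(n,1/2,⌈n^{1/2-δ}⌉)}[∃ E ∈ 𝓔 n, E ⊆ x] → 0` too. Proof: `dnf_planted_le_null_add`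
(witness lemma + hypergeometric tails) bounds it by `2^{C(2c+3,2)} · null + 2/n²` eventually. [folklore] -/
theorem karlinRubin_dnf_planted_tendsto_zero {δ : ℝ} (hδ : 0 < δ) (hδ' : δ < 1 / 2) (c : ℕ)
    (𝓔 : (n : ℕ) → Finset (Finset (⊤ : SimpleGraph (Fin n)).edgeSet))
    (hM : ∀ᶠ n : ℕ in atTop, #(𝓔 n) ≤ n ^ c)
    (hquiet : Tendsto (fun n : ℕ =>
      (erdosRenyiHalf n).toOuterMeasure {x | ∃ E ∈ 𝓔 n, ∀ e ∈ E, x e = true}) atTop (𝓝 0)) :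
    Tendsto (fun n : ℕ => (plantedCliqueDist n ⌈(n : ℝ) ^ (1 / 2 - δ)⌉₊).toOuterMeasure
      {x | ∃ E ∈ 𝓔 n, ∀ e ∈ E, x e = true}) atTop (𝓝 0) := by
  set t := (2 * (c + 2) - 1).choose 2 with ht
  -- the bound `2^t · null + 2 (n²)⁻¹ → 0`
  have hinv : Tendsto (fun n : ℕ => (((n ^ 2 : ℕ) : ℝ≥0∞))⁻¹) atTop (𝓝 0) := by
    refine tendsto_of_tendsto_of_tendsto_of_le_of_le' tendsto_const_nhds ENNReal.tendsto_inv_nat_nhds_zero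
      (Eventually.of_forall fun _ => bot_le) ?_
    filter_upwards [eventually_ge_atTop 1] with n hn
    apply ENNReal.inv_le_inv.2
    exact_mod_cast (Nat.le_self_pow two_ne_zero n)
  have hbound : Tendsto (fun n : ℕ => (2 : ℝ≥0∞) ^ t *
      (erdosRenyiHalf n).toOuterMeasure {x | ∃ E ∈ 𝓔 n, ∀ e ∈ E, x e = true} +
        2 * (((n ^ 2 : ℕ) : ℝ≥0∞))⁻¹) atTop (𝓝 0) := by
    have h1 := ENNReal.Tendsto.const_mul hquiet (Or.inr (ENNReal.pow_ne_top ENNReal.ofNat_ne_top) :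
      (0 : ℝ≥0∞) ≠ 0 ∨ (2 : ℝ≥0∞) ^ t ≠ ⊤)
    have h2 := ENNReal.Tendsto.const_mul hinv (Or.inr ENNReal.ofNat_ne_top : (0 : ℝ≥0∞) ≠ 0 ∨ (2 : ℝ≥0∞) ≠ ⊤)
    simpa using h1.add h2
  refine tendsto_of_tendsto_of_tendsto_of_le_of_le' tendsto_const_nhds hbound
    (Eventually.of_forall fun _ => bot_le) ?_
  have hL : ∀ᶠ n : ℕ in atTop, c + 3 ≤ Nat.log 2 n := by
    filter_upwards [eventually_ge_atTop (2 ^ (c + 3))] with n hn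
    exact Nat.le_log_of_pow_le one_lt_two hn
  filter_upwards [hM, eventually_H1 hδ hδ', eventually_H2 hδ hδ', eventually_H3 hδ hδ', hL, eventually_ge_atTop 1]
    with n hMn H1 H2 H3 hLn hn1
  exact dnf_planted_le_null_add hn1 _ H1 H2 H3 hLn (Nat.lt_pow_succ_log_self one_lt_two n) (𝓔 n) hMn

/-- **`MonotoneBlind` for monotone DNFs (depth 2, any widths).** For `0 < δ < 1/2` and every `c`, NO family of
monotone DNFs with `≤ n^c` terms has `Pr_{G(n,1/2)}[accept] + Pr_{G(n,1/2,⌈n^{1/2-δ}⌉)}[reject] → 0`: the error sum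
forces the null acceptance to `0`, hence (previous theorem) the planted acceptance to `0`, i.e. the planted
rejection to `1`. [folklore] -/
theorem karlinRubin_monotoneBlind_dnf {δ : ℝ} (hδ : 0 < δ) (hδ' : δ < 1 / 2) (c : ℕ) :
    ¬ ∃ 𝓔 : (n : ℕ) → Finset (Finset (⊤ : SimpleGraph (Fin n)).edgeSet),
      (∀ᶠ n : ℕ in atTop, #(𝓔 n) ≤ n ^ c) ∧
      Tendsto (fun n : ℕ =>
        (erdosRenyiHalf n).toOuterMeasure {x | ∃ E ∈ 𝓔 n, ∀ e ∈ E, x e = true} +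
          (plantedCliqueDist n ⌈(n : ℝ) ^ (1 / 2 - δ)⌉₊).toOuterMeasure
            {x | ¬ ∃ E ∈ 𝓔 n, ∀ e ∈ E, x e = true}) atTop (𝓝 0) := by
  rintro ⟨𝓔, hM, hT⟩
  have hquiet : Tendsto (fun n : ℕ =>
      (erdosRenyiHalf n).toOuterMeasure {x | ∃ E ∈ 𝓔 n, ∀ e ∈ E, x e = true}) atTop (𝓝 0) :=
    tendsto_of_tendsto_of_tendsto_of_le_of_le' tendsto_const_nhds hT (Eventually.of_forall fun _ => bot_le)
      (Eventually.of_forall fun _ => le_self_add)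
  have hP := karlinRubin_dnf_planted_tendsto_zero hδ hδ' c 𝓔 hM hquiet
  have hhalf : (0 : ℝ≥0∞) < 1 / 2 := by simp
  obtain ⟨n, hn1, hn2⟩ := ((hT.eventually (gt_mem_nhds hhalf)).and (hP.eventually (gt_mem_nhds hhalf))).exists
  have hcompl : (plantedCliqueDist n ⌈(n : ℝ) ^ (1 / 2 - δ)⌉₊).toOuterMeasure {x | ∃ E ∈ 𝓔 n, ∀ e ∈ E, x e = true} +
      (plantedCliqueDist n ⌈(n : ℝ) ^ (1 / 2 - δ)⌉₊).toOuterMeasure {x | ¬ ∃ E ∈ 𝓔 n, ∀ e ∈ E, x e = true} = 1 := by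
    have h := (plantedCliqueDist n ⌈(n : ℝ) ^ (1 / 2 - δ)⌉₊).toOuterMeasure_add_compl
      {x | ∃ E ∈ 𝓔 n, ∀ e ∈ E, x e = true}
    have hc : {x : EdgeVec n | ¬ ∃ E ∈ 𝓔 n, ∀ e ∈ E, x e = true} =
        {x : EdgeVec n | ∃ E ∈ 𝓔 n, ∀ e ∈ E, x e = true}ᶜ := by
      ext x; simp
    rw [hc]
    exact h
  have hR : (plantedCliqueDist n ⌈(n : ℝ) ^ (1 / 2 - δ)⌉₊).toOuterMeasure
      {x | ¬ ∃ E ∈ 𝓔 n, ∀ e ∈ E, x e = true} < 1 / 2 := lt_of_le_of_lt le_add_self hn1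
  have hlt : (1 : ℝ≥0∞) < 1 / 2 + 1 / 2 := by
    calc (1 : ℝ≥0∞) = _ := hcompl.symm
      _ < 1 / 2 + 1 / 2 := ENNReal.add_lt_add hn2 hR
  rw [ENNReal.add_halves] at hlt
  exact lt_irrefl _ hlt

/-- **No circuit family computing polynomial-term monotone DNFs strongly detects** (the crux `MonotoneBlind`
restricted to depth 2, for circuits over ANY basis and of any size, as long as what they compute is an OR of
`≤ n^c` edge-set indicators eventually). [folklore] -/
theorem karlinRubin_not_detects_of_computes_dnf {δ : ℝ} (hδ : 0 < δ) (hδ' : δ < 1 / 2) (c : ℕ)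
    (C : (n : ℕ) → Circuit ((⊤ : SimpleGraph (Fin n)).edgeSet))
    (𝓔 : (n : ℕ) → Finset (Finset (⊤ : SimpleGraph (Fin n)).edgeSet))
    (hC : ∀ᶠ n : ℕ in atTop, ∀ x, (C n).eval x = true ↔ ∃ E ∈ 𝓔 n, ∀ e ∈ E, x e = true)
    (hM : ∀ᶠ n : ℕ in atTop, #(𝓔 n) ≤ n ^ c) :
    ¬ Tendsto (fun n : ℕ =>
        (erdosRenyiHalf n).toOuterMeasure {x | (C n).eval x = true} +
          (plantedCliqueDist n ⌈(n : ℝ) ^ (1 / 2 - δ)⌉₊).toOuterMeasure {x | (C n).eval x = false})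
        atTop (𝓝 0) := by
  intro hT
  refine karlinRubin_monotoneBlind_dnf hδ hδ' c ⟨𝓔, hM, hT.congr' ?_⟩
  filter_upwards [hC] with n hn
  have h1 : {x : EdgeVec n | (C n).eval x = true} = {x | ∃ E ∈ 𝓔 n, ∀ e ∈ E, x e = true} := by
    ext x; exact hn x
  have h2 : {x : EdgeVec n | (C n).eval x = false} = {x | ¬ ∃ E ∈ 𝓔 n, ∀ e ∈ E, x e = true} := by
    ext x
    simp only [Set.mem_setOf_eq, ← hn x, Bool.not_eq_true]
  rw [h1, h2]

end Summit.PneNP.PneNP.Theorems
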